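import Mathlib
import HarnessLib
import Summits.HubbardSuperconductivity.HubbardSuperconductivity.Theorems.WeakCouplingBCSDefsKlCertB1gWinXRecord
import Summits.HubbardSuperconductivity.HubbardSuperconductivity.Theorems.WeakCouplingBCSDefsKlCertB1gWinYRecord
import Summits.HubbardSuperconductivity.HubbardSuperconductivity.Theorems.WeakCouplingBCSDefsKlCertB1gWinZRecord
import Summits.HubbardSuperconductivity.HubbardSuperconductivity.Theorems.WeakCouplingBCSDefsKlU0WindowD010D030Record
import Summits.HubbardSuperconductivity.HubbardSuperconductivity.Theorems.WeakCouplingBCSDefsKlU0WindowYXRecord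
import Summits.HubbardSuperconductivity.HubbardSuperconductivity.Theorems.WeakCouplingBCSDefsKlU0WindowZRecord
import Summits.HubbardSuperconductivity.HubbardSuperconductivity.Theorems.WeakCouplingBCSKlAllOrdersSelectionWindow
import Summits.HubbardSuperconductivity.HubbardSuperconductivity.Theorems.WeakCouplingBCSKlSelectionBoxwiseRows
import Summits.HubbardSuperconductivity.HubbardSuperconductivity.Theorems.WeakCouplingBCSKlSelectionJoinRows
import Summits.HubbardSuperconductivity.HubbardSuperconductivity.Theorems.WeakCouplingBCSKlSelectionWindowRows
import Summits.HubbardSuperconductivity.HubbardSuperconductivity.Theorems.WeakCouplingBCSKlThirdOrderSelectionWindow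
import Summits.HubbardSuperconductivity.HubbardSuperconductivity.Theorems.WeakCouplingBCSWcbcsKohnLuttingerB1gFormAWindowD005D030

/-!
# Route `WeakCouplingBCS` — channel-margin lane of `WcbcsKohnLuttingerB1g` (stmt-HubbardSuperconductivity-0158):
# `B1g` SELECTION THROUGH THIRD ORDER / RESUMMED CHAINS / ALL ORDERS / CHANNEL BOTTOMS ON `μ ∈ [-0.7275, -0.1775] ⊃ μ([0.10, 0.30])`

Instances, on the joined window `klU0WindowD010D030Rows` (`Theorems/WeakCouplingBCSDefsKlU0WindowD010D030Record.lean`, 120 rows), of the generic window-rows theorems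
(`Theorems/WeakCouplingBCSKlThirdOrderSelectionWindow.lean`, `…KlSelectionWindowRows.lean`, `…KlSelectionBoxwiseRows.lean`), the join / constants facts assembled from
per-piece kernel decisions by `…KlSelectionJoinRows.lean`: for EVERY `μ ∈ [-0.7275, -0.1775]` (every hole doping `δ ∈ [0.10, 0.30]`) and every `0 < U ≤ klU0WindowD010D030U`
the `B1g` Ritz trial of the record box containing `μ` lies strictly below every normalised `A1g/A2g/B2g/E` state in the pp-irreducible Cooper vertex `Γ_U/U²` through
third order (chains resummed; to all orders for every remainder with the `C4 = 10` form bound), `B1g` has the strictly lowest third-order channel bottom, and BOX-WISE the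
same holds up to each row's own `U0` (3.4·10⁻⁴ … 8.3·10⁻⁴ on the new pieces) — modulo the NAMED hypotheses `klCertB1gWin{Y,X,Z,A,B,C}.EnclosuresB1g` (second order; cert-2 /
margin-2, two implementations, referee-replayed) and the rows' named third-order / resummed window hypotheses (margin-1 FLOOR + chain layer, two implementations;
U0-TABLE.md v3 §4, v4 §B).  Existence-grade thresholds; `C4` ASSUMED; nothing here asserts superconductivity.

References: D. J. Scalapino, E. Loh, J. E. Hirsch, Phys. Rev. B 34 (1986) 8190, (3)–(4); S. Raghu, S. A. Kivelson, D. J. Scalapino,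
Phys. Rev. B 81 (2010) 224505, App. A.
-/

noncomputable section

-- the tree's namespace `Summit.<Summit>.<Problem>.Theorems` repeats the summit name by design (D-0017)
set_option linter.dupNamespace false

namespace Summit.HubbardSuperconductivity.HubbardSuperconductivity.Theorems

open MeasureTheory Literature.MathematicalPhysics.QuantumLattice CwKLChiralWindow KlThirdOrder
open Summit.HubbardSuperconductivity.HubbardSuperconductivity.Theses.WeakCouplingBCS

/-! ### Per-piece kernel facts (join to the second-order records, common constants) and their concatenation -/

/-- Kernel decision: every row of `klU0WindowYXRows` sits in a box of `klCertB1gWinY` / `klCertB1gWinX` with which it is consistent. [folklore] -/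
theorem klsel_d010d030_join0 : klThirdOrderWindowJoin klU0WindowYXRows [klCertB1gWinY, klCertB1gWinX] = true := by
  decide +kernel

/-- Kernel decision: every row of `klU0WindowYXRows` carries `C4 = 10` and `U1 = 1/16`. [folklore] -/
theorem klsel_d010d030_consts0 :
    (klU0WindowYXRows.all fun w => decide (w.row.C4 = (10 : ℚ)) && decide (w.row.U1 = ((1 : ℚ) / 16))) = true := by
  decide +kernel

/-- Kernel decision: every row of `klU0WindowZRows` sits in a box of `klCertB1gWinZ` with which it is consistent. [folklore] -/
theorem klsel_d010d030_join1 : klThirdOrderWindowJoin klU0WindowZRows [klCertB1gWinZ] = true := by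
  decide +kernel

/-- Kernel decision: every row of `klU0WindowZRows` carries `C4 = 10` and `U1 = 1/16`. [folklore] -/
theorem klsel_d010d030_consts1 :
    (klU0WindowZRows.all fun w => decide (w.row.C4 = (10 : ℚ)) && decide (w.row.U1 = ((1 : ℚ) / 16))) = true := by
  decide +kernel

/-- **The joined rows are joined to the union of the second-order records** (from the per-piece kernel decisions by `klThirdOrderWindowJoin_append_of`). [folklore] -/
theorem klsel_d010d030_join : klThirdOrderWindowJoin klU0WindowD010D030Rows [klCertB1gWinY, klCertB1gWinX, klCertB1gWinZ, klCertB1gWinA, klCertB1gWinB, klCertB1gWinC] = true := by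
  have h : klThirdOrderWindowJoin (klU0WindowYXRows ++ klU0WindowZRows ++ klU0WindowRows) ([klCertB1gWinY, klCertB1gWinX] ++ [klCertB1gWinZ] ++ [klCertB1gWinA, klCertB1gWinB, klCertB1gWinC]) = true :=
    klThirdOrderWindowJoin_append_of (klThirdOrderWindowJoin_append_of (klsel_d010d030_join0) klsel_d010d030_join1) klto_window_join
  exact h

/-- Every row of the joined list carries `C4 = 10` and `U1 = 1/16`. [folklore] -/
theorem klsel_d010d030_consts :
    (klU0WindowD010D030Rows.all fun w => decide (w.row.C4 = (10 : ℚ)) && decide (w.row.U1 = ((1 : ℚ) / 16))) = true := by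
  have h : ((klU0WindowYXRows ++ klU0WindowZRows ++ klU0WindowRows).all fun w => decide (w.row.C4 = (10 : ℚ)) && decide (w.row.U1 = ((1 : ℚ) / 16))) = true :=
    klWindowRowsConsts_append (klWindowRowsConsts_append (klsel_d010d030_consts0) klsel_d010d030_consts1) klaow_rows_consts
  exact h

/-- The 6 second-order window records pass the multiplicity-aware checker (kernel decisions of their record files) and carry their enclosures. [folklore] -/
theorem klsel_d010d030_recs (hY : klCertB1gWinY.EnclosuresB1g) (hX : klCertB1gWinX.EnclosuresB1g) (hZ : klCertB1gWinZ.EnclosuresB1g) (hA : klCertB1gWinA.EnclosuresB1g) (hB : klCertB1gWinB.EnclosuresB1g) (hC : klCertB1gWinC.EnclosuresB1g) :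
    ∀ c ∈ [klCertB1gWinY, klCertB1gWinX, klCertB1gWinZ, klCertB1gWinA, klCertB1gWinB, klCertB1gWinC], c.checkB1gD = true ∧ c.EnclosuresB1g := by
  intro c hc
  simp only [List.mem_cons, List.mem_nil_iff, or_false] at hc
  rcases hc with rfl | rfl | rfl | rfl | rfl | rfl
  · exact ⟨klCertB1gWinY_check, hY⟩
  · exact ⟨klCertB1gWinX_check, hX⟩
  · exact ⟨klCertB1gWinZ_check, hZ⟩
  · exact ⟨klCertB1gWinA_check, hA⟩
  · exact ⟨klCertB1gWinB_check, hB⟩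
  · exact ⟨klCertB1gWinC_check, hC⟩

/-! ### Window-uniform statements on `μ ∈ [-0.7275, -0.1775]` -/

/-- **`B1g` selection survives the complete THIRD ORDER of the pp-irreducible Cooper vertex for every `μ ∈ [-0.7275, -0.1775]` and every
`0 < U ≤ klU0WindowD010D030U`**: some `B1g` channel state on `F_μ` lies strictly below every normalised `A1g/A2g/B2g/E` state of `thirdOrderForm ε₀ μ U` —
modulo the NAMED numerical hypotheses `klCertB1gWin*.EnclosuresB1g` of the 6 second-order window records (certified interval computation of the
cell's window lanes, two implementations each) and the named window hypotheses of `klU0WindowD010D030Rows` (third order / resummed chains; certified in two interval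
implementations on every box, U0-TABLE.md v3–v4).  Existence-grade threshold; nothing here asserts a pairing instability. [cite: RaghuKivelsonScalapino2010, App. A] -/
theorem klThirdOrder_selection_d010d030 (hY : klCertB1gWinY.EnclosuresB1g) (hX : klCertB1gWinX.EnclosuresB1g) (hZ : klCertB1gWinZ.EnclosuresB1g) (hA : klCertB1gWinA.EnclosuresB1g) (hB : klCertB1gWinB.EnclosuresB1g) (hC : klCertB1gWinC.EnclosuresB1g)
    (h3 : KlThirdOrderWindowEnclosures klU0WindowD010D030Rows [klCertB1gWinY, klCertB1gWinX, klCertB1gWinZ, klCertB1gWinA, klCertB1gWinB, klCertB1gWinC]) :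
    ∀ μ : ℝ, ((((-291 : ℚ) / 400) : ℚ) : ℝ) ≤ μ → μ ≤ ((((-71 : ℚ) / 400) : ℚ) : ℝ) →
      ∃ ψ : Momentum → ℝ, IsChannelState (squareDispersion 1 0) μ D4Irrep.B1g ψ ∧
        ∀ U : ℝ, 0 < U → U ≤ ((klU0WindowD010D030U : ℚ) : ℝ) → ∀ χ : D4Irrep, χ ≠ D4Irrep.B1g →
          ∀ φ : Momentum → ℝ, IsChannelState (squareDispersion 1 0) μ χ φ →
            thirdOrderForm (squareDispersion 1 0) μ U ψ < thirdOrderForm (squareDispersion 1 0) μ U φ :=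
  klThirdOrder_selection_windowRows klU0WindowD010D030Rows _ _ _ _ klU0WindowD010D030Rows_check klsel_d010d030_join (klsel_d010d030_recs hY hX hZ hA hB hC) h3

/-- **Chains RESUMMED, every `μ ∈ [-0.7275, -0.1775]`, `0 < U ≤ klU0WindowD010D030U`** — modulo the NAMED numerical hypotheses `klCertB1gWin*.EnclosuresB1g` of the 6 second-order window records (certified interval computation of the
cell's window lanes, two implementations each) and the named window hypotheses of `klU0WindowD010D030Rows` (third order / resummed chains; certified in two interval
implementations on every box, U0-TABLE.md v3–v4).  Existence-grade threshold; nothing here asserts a pairing instability. [cite: ScalapinoLohHirsch1986, (3)-(4)] -/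
theorem klResummed_selection_d010d030 (hY : klCertB1gWinY.EnclosuresB1g) (hX : klCertB1gWinX.EnclosuresB1g) (hZ : klCertB1gWinZ.EnclosuresB1g) (hA : klCertB1gWinA.EnclosuresB1g) (hB : klCertB1gWinB.EnclosuresB1g) (hC : klCertB1gWinC.EnclosuresB1g)
    (h3 : KlResummedWindowEnclosures klU0WindowD010D030Rows [klCertB1gWinY, klCertB1gWinX, klCertB1gWinZ, klCertB1gWinA, klCertB1gWinB, klCertB1gWinC]) :
    ∀ μ : ℝ, ((((-291 : ℚ) / 400) : ℚ) : ℝ) ≤ μ → μ ≤ ((((-71 : ℚ) / 400) : ℚ) : ℝ) →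
      ∃ ψ : Momentum → ℝ, IsChannelState (squareDispersion 1 0) μ D4Irrep.B1g ψ ∧
        ∀ U : ℝ, 0 < U → U ≤ ((klU0WindowD010D030U : ℚ) : ℝ) → ∀ χ : D4Irrep, χ ≠ D4Irrep.B1g →
          ∀ φ : Momentum → ℝ, IsChannelState (squareDispersion 1 0) μ χ φ →
            resummedForm (squareDispersion 1 0) μ U ψ < resummedForm (squareDispersion 1 0) μ U φ :=
  klResummed_selection_windowRows klU0WindowD010D030Rows _ _ _ _ klU0WindowD010D030Rows_check klsel_d010d030_join (klsel_d010d030_recs hY hX hZ hA hB hC) h3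

/-- **ALL ORDERS, every `μ ∈ [-0.7275, -0.1775]`, `0 < U ≤ klU0WindowD010D030U`**, for EVERY coupling-dependent remainder kernel `R` (the non-chain diagrams of order `≥ 4`
of `Γ_U/U⁴`) whose form is `≤ 10‖Φ_B‖²` on the `B1g` trial of every record box and `≥ -10` on normalised competitor states for `0 < U ≤ 1/16` — the
rows' ASSUMED `C4 = 10` column as a theorem; modulo the NAMED numerical hypotheses `klCertB1gWin*.EnclosuresB1g` of the 6 second-order window records (certified interval computation of the
cell's window lanes, two implementations each) and the named window hypotheses of `klU0WindowD010D030Rows` (third order / resummed chains; certified in two interval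
implementations on every box, U0-TABLE.md v3–v4).  Existence-grade threshold; nothing here asserts a pairing instability. [cite: RaghuKivelsonScalapino2010, App. A] -/
theorem klAllOrders_selection_d010d030 (hY : klCertB1gWinY.EnclosuresB1g) (hX : klCertB1gWinX.EnclosuresB1g) (hZ : klCertB1gWinZ.EnclosuresB1g) (hA : klCertB1gWinA.EnclosuresB1g) (hB : klCertB1gWinB.EnclosuresB1g) (hC : klCertB1gWinC.EnclosuresB1g)
    (h3 : KlResummedWindowEnclosures klU0WindowD010D030Rows [klCertB1gWinY, klCertB1gWinX, klCertB1gWinZ, klCertB1gWinA, klCertB1gWinB, klCertB1gWinC])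
    (R : ℝ → Momentum → Momentum → ℝ)
    (hRB : ∀ c ∈ [klCertB1gWinY, klCertB1gWinX, klCertB1gWinZ, klCertB1gWinA, klCertB1gWinB, klCertB1gWinC], ∀ bx ∈ c.boxes, ∀ μ : ℝ,
      ((bx.mulo : ℚ) : ℝ) ≤ μ → μ ≤ ((bx.muhi : ℚ) : ℝ) → ∀ U : ℝ, 0 < U → U ≤ ((((1 : ℚ) / 16) : ℚ) : ℝ) →
        kform (fermiCurveMeasure (squareDispersion 1 0) μ) (R U) (bx.bB1g.trialFun c.trials) ≤
          (((10 : ℚ) : ℚ) : ℝ) * ∫ k, bx.bB1g.trialFun c.trials k ^ 2 ∂fermiCurveMeasure (squareDispersion 1 0) μ)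
    (hRχ : ∀ μ : ℝ, ((((-291 : ℚ) / 400) : ℚ) : ℝ) ≤ μ → μ ≤ ((((-71 : ℚ) / 400) : ℚ) : ℝ) →
      ∀ U : ℝ, 0 < U → U ≤ ((((1 : ℚ) / 16) : ℚ) : ℝ) → ∀ χ : D4Irrep, χ ≠ D4Irrep.B1g →
        ∀ φ : Momentum → ℝ, IsChannelState (squareDispersion 1 0) μ χ φ →
          -(((10 : ℚ) : ℚ) : ℝ) ≤ kform (fermiCurveMeasure (squareDispersion 1 0) μ) (R U) φ) :
    ∀ μ : ℝ, ((((-291 : ℚ) / 400) : ℚ) : ℝ) ≤ μ → μ ≤ ((((-71 : ℚ) / 400) : ℚ) : ℝ) →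
      ∃ ψ : Momentum → ℝ, IsChannelState (squareDispersion 1 0) μ D4Irrep.B1g ψ ∧
        ∀ U : ℝ, 0 < U → U ≤ ((klU0WindowD010D030U : ℚ) : ℝ) → ∀ χ : D4Irrep, χ ≠ D4Irrep.B1g →
          ∀ φ : Momentum → ℝ, IsChannelState (squareDispersion 1 0) μ χ φ →
            resummedForm (squareDispersion 1 0) μ U ψ + U ^ 2 * kform (fermiCurveMeasure (squareDispersion 1 0) μ) (R U) ψ <
              resummedForm (squareDispersion 1 0) μ U φ + U ^ 2 * kform (fermiCurveMeasure (squareDispersion 1 0) μ) (R U) φ :=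
  klAllOrders_selection_windowRows klU0WindowD010D030Rows _ _ _ _ _ _ klU0WindowD010D030Rows_check klsel_d010d030_join (klsel_d010d030_recs hY hX hZ hA hB hC) h3 klsel_d010d030_consts R hRB hRχ

/-- **`B1g` trial below every competitor's third-order CHANNEL BOTTOM, every `μ ∈ [-0.7275, -0.1775]`, `0 < U ≤ klU0WindowD010D030U`** —
modulo the NAMED numerical hypotheses `klCertB1gWin*.EnclosuresB1g` of the 6 second-order window records (certified interval computation of the
cell's window lanes, two implementations each) and the named window hypotheses of `klU0WindowD010D030Rows` (third order / resummed chains; certified in two interval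
implementations on every box, U0-TABLE.md v3–v4).  Existence-grade threshold; nothing here asserts a pairing instability. [cite: RaghuKivelsonScalapino2010, App. A] -/
theorem klThirdOrder_lt_channelInf3_d010d030 (hY : klCertB1gWinY.EnclosuresB1g) (hX : klCertB1gWinX.EnclosuresB1g) (hZ : klCertB1gWinZ.EnclosuresB1g) (hA : klCertB1gWinA.EnclosuresB1g) (hB : klCertB1gWinB.EnclosuresB1g) (hC : klCertB1gWinC.EnclosuresB1g)
    (h3 : KlThirdOrderWindowEnclosures klU0WindowD010D030Rows [klCertB1gWinY, klCertB1gWinX, klCertB1gWinZ, klCertB1gWinA, klCertB1gWinB, klCertB1gWinC]) :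
    ∀ μ : ℝ, ((((-291 : ℚ) / 400) : ℚ) : ℝ) ≤ μ → μ ≤ ((((-71 : ℚ) / 400) : ℚ) : ℝ) →
      ∃ ψ : Momentum → ℝ, IsChannelState (squareDispersion 1 0) μ D4Irrep.B1g ψ ∧
        ∀ U : ℝ, 0 < U → U ≤ ((klU0WindowD010D030U : ℚ) : ℝ) → ∀ χ : D4Irrep, χ ≠ D4Irrep.B1g →
          thirdOrderForm (squareDispersion 1 0) μ U ψ < channelInf3 (squareDispersion 1 0) μ U χ :=
  klThirdOrder_lt_channelInf3_windowRows klU0WindowD010D030Rows _ _ _ _ klU0WindowD010D030Rows_check klsel_d010d030_join (klsel_d010d030_recs hY hX hZ hA hB hC) h3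

/-- **`B1g` has the strictly lowest third-order channel bottom, every `μ ∈ [-0.7275, -0.1775]`, `0 < U ≤ klU0WindowD010D030U`, every `χ ∈ {A1g, A2g, B2g, E}`** —
modulo the NAMED numerical hypotheses `klCertB1gWin*.EnclosuresB1g` of the 6 second-order window records (certified interval computation of the
cell's window lanes, two implementations each) and the named window hypotheses of `klU0WindowD010D030Rows` (third order / resummed chains; certified in two interval
implementations on every box, U0-TABLE.md v3–v4).  Existence-grade threshold; nothing here asserts a pairing instability.  Extra named hypothesis: per row, its `A2g` datum read on the `B1g` states (channel-independent Hilbert–Schmidt numbers, valid on every even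
state). [cite: RaghuKivelsonScalapino2010, App. A] -/
theorem klThirdOrder_channelInf3_lt_d010d030 (hY : klCertB1gWinY.EnclosuresB1g) (hX : klCertB1gWinX.EnclosuresB1g) (hZ : klCertB1gWinZ.EnclosuresB1g) (hA : klCertB1gWinA.EnclosuresB1g) (hB : klCertB1gWinB.EnclosuresB1g) (hC : klCertB1gWinC.EnclosuresB1g)
    (h3 : KlThirdOrderWindowEnclosures klU0WindowD010D030Rows [klCertB1gWinY, klCertB1gWinX, klCertB1gWinZ, klCertB1gWinA, klCertB1gWinB, klCertB1gWinC])
    (hB1g : ∀ w ∈ klU0WindowD010D030Rows, ∀ μ : ℝ, ((w.mulo : ℚ) : ℝ) ≤ μ → μ ≤ ((w.muhi : ℚ) : ℝ) →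
      (w.row.chanOf D4Irrep.A2g).ThirdOrderLowerBound μ D4Irrep.B1g) :
    ∀ μ : ℝ, ((((-291 : ℚ) / 400) : ℚ) : ℝ) ≤ μ → μ ≤ ((((-71 : ℚ) / 400) : ℚ) : ℝ) →
      ∀ U : ℝ, 0 < U → U ≤ ((klU0WindowD010D030U : ℚ) : ℝ) → ∀ χ : D4Irrep, χ ≠ D4Irrep.B1g →
        channelInf3 (squareDispersion 1 0) μ U D4Irrep.B1g < channelInf3 (squareDispersion 1 0) μ U χ :=
  klThirdOrder_channelInf3_lt_windowRows klU0WindowD010D030Rows _ _ _ _ klU0WindowD010D030Rows_check klsel_d010d030_join (klsel_d010d030_recs hY hX hZ hA hB hC) h3 hB1g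

/-! ### Box-wise thresholds `U₀(μ)`: for every row `w`, every `μ` of its box, `0 < U ≤ w.row.U0` -/

/-- **Box-wise third-order selection on the joined window**: thresholds `w.row.U0` per box. [cite: RaghuKivelsonScalapino2010, App. A] -/
theorem klThirdOrder_selection_d010d030_boxwise (hY : klCertB1gWinY.EnclosuresB1g) (hX : klCertB1gWinX.EnclosuresB1g) (hZ : klCertB1gWinZ.EnclosuresB1g) (hA : klCertB1gWinA.EnclosuresB1g) (hB : klCertB1gWinB.EnclosuresB1g) (hC : klCertB1gWinC.EnclosuresB1g)
    (h3 : KlThirdOrderWindowEnclosures klU0WindowD010D030Rows [klCertB1gWinY, klCertB1gWinX, klCertB1gWinZ, klCertB1gWinA, klCertB1gWinB, klCertB1gWinC]) :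
    ∀ w ∈ klU0WindowD010D030Rows, ∀ μ : ℝ, ((w.mulo : ℚ) : ℝ) ≤ μ → μ ≤ ((w.muhi : ℚ) : ℝ) →
      ∃ ψ : Momentum → ℝ, IsChannelState (squareDispersion 1 0) μ D4Irrep.B1g ψ ∧
        ∀ U : ℝ, 0 < U → U ≤ ((w.row.U0 : ℚ) : ℝ) → ∀ χ : D4Irrep, χ ≠ D4Irrep.B1g →
          ∀ φ : Momentum → ℝ, IsChannelState (squareDispersion 1 0) μ χ φ →
            thirdOrderForm (squareDispersion 1 0) μ U ψ < thirdOrderForm (squareDispersion 1 0) μ U φ :=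
  klThirdOrder_selection_boxwiseRows klU0WindowD010D030Rows _ _ _ _ klU0WindowD010D030Rows_check klsel_d010d030_join (klsel_d010d030_recs hY hX hZ hA hB hC) h3

/-- **Box-wise selection with the chains resummed on the joined window.** [cite: ScalapinoLohHirsch1986, (3)-(4)] -/
theorem klResummed_selection_d010d030_boxwise (hY : klCertB1gWinY.EnclosuresB1g) (hX : klCertB1gWinX.EnclosuresB1g) (hZ : klCertB1gWinZ.EnclosuresB1g) (hA : klCertB1gWinA.EnclosuresB1g) (hB : klCertB1gWinB.EnclosuresB1g) (hC : klCertB1gWinC.EnclosuresB1g)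
    (h3 : KlResummedWindowEnclosures klU0WindowD010D030Rows [klCertB1gWinY, klCertB1gWinX, klCertB1gWinZ, klCertB1gWinA, klCertB1gWinB, klCertB1gWinC]) :
    ∀ w ∈ klU0WindowD010D030Rows, ∀ μ : ℝ, ((w.mulo : ℚ) : ℝ) ≤ μ → μ ≤ ((w.muhi : ℚ) : ℝ) →
      ∃ ψ : Momentum → ℝ, IsChannelState (squareDispersion 1 0) μ D4Irrep.B1g ψ ∧
        ∀ U : ℝ, 0 < U → U ≤ ((w.row.U0 : ℚ) : ℝ) → ∀ χ : D4Irrep, χ ≠ D4Irrep.B1g →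
          ∀ φ : Momentum → ℝ, IsChannelState (squareDispersion 1 0) μ χ φ →
            resummedForm (squareDispersion 1 0) μ U ψ < resummedForm (squareDispersion 1 0) μ U φ :=
  klResummed_selection_boxwiseRows klU0WindowD010D030Rows _ _ _ _ klU0WindowD010D030Rows_check klsel_d010d030_join (klsel_d010d030_recs hY hX hZ hA hB hC) h3

/-- **Box-wise channel bottoms on the joined window**: for every row `w`, every `μ` of its box, `0 < U ≤ w.row.U0`, every `χ ≠ B1g`:
`channelInf3 ε₀ μ U B1g < channelInf3 ε₀ μ U χ`. [cite: RaghuKivelsonScalapino2010, App. A] -/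
theorem klThirdOrder_channelInf3_lt_d010d030_boxwise (hY : klCertB1gWinY.EnclosuresB1g) (hX : klCertB1gWinX.EnclosuresB1g) (hZ : klCertB1gWinZ.EnclosuresB1g) (hA : klCertB1gWinA.EnclosuresB1g) (hB : klCertB1gWinB.EnclosuresB1g) (hC : klCertB1gWinC.EnclosuresB1g)
    (h3 : KlThirdOrderWindowEnclosures klU0WindowD010D030Rows [klCertB1gWinY, klCertB1gWinX, klCertB1gWinZ, klCertB1gWinA, klCertB1gWinB, klCertB1gWinC])
    (hB1g : ∀ w ∈ klU0WindowD010D030Rows, ∀ μ : ℝ, ((w.mulo : ℚ) : ℝ) ≤ μ → μ ≤ ((w.muhi : ℚ) : ℝ) →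
      (w.row.chanOf D4Irrep.A2g).ThirdOrderLowerBound μ D4Irrep.B1g) :
    ∀ w ∈ klU0WindowD010D030Rows, ∀ μ : ℝ, ((w.mulo : ℚ) : ℝ) ≤ μ → μ ≤ ((w.muhi : ℚ) : ℝ) →
      ∀ U : ℝ, 0 < U → U ≤ ((w.row.U0 : ℚ) : ℝ) → ∀ χ : D4Irrep, χ ≠ D4Irrep.B1g →
        channelInf3 (squareDispersion 1 0) μ U D4Irrep.B1g < channelInf3 (squareDispersion 1 0) μ U χ :=
  klThirdOrder_channelInf3_lt_boxwiseRows klU0WindowD010D030Rows _ _ _ _ klU0WindowD010D030Rows_check klsel_d010d030_join (klsel_d010d030_recs hY hX hZ hA hB hC) h3 hB1g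

/-! ### Indexed by the doping `δ ∈ [0.10, 0.30]` (`muOfDoping_mem_window_d010_d030`: certified fillings n(-0.7275) < 7/10, n(-0.1775) ≥ 9/10) -/

/-- **For every `δ ∈ [0.10, 0.30]`, at `μ(δ) = chemicalPotentialOfDensity ε₀ (1-δ)`: third-order `B1g` selection for `0 < U ≤ klU0WindowD010D030U`**,
modulo the same named hypotheses. [cite: RaghuKivelsonScalapino2010, App. A] -/
theorem klThirdOrder_selection_d010d030_doping (hY : klCertB1gWinY.EnclosuresB1g) (hX : klCertB1gWinX.EnclosuresB1g) (hZ : klCertB1gWinZ.EnclosuresB1g) (hA : klCertB1gWinA.EnclosuresB1g) (hB : klCertB1gWinB.EnclosuresB1g) (hC : klCertB1gWinC.EnclosuresB1g)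
    (h3 : KlThirdOrderWindowEnclosures klU0WindowD010D030Rows [klCertB1gWinY, klCertB1gWinX, klCertB1gWinZ, klCertB1gWinA, klCertB1gWinB, klCertB1gWinC])
    (δ : ℝ) (hδ : δ ∈ Set.Icc (0.10 : ℝ) 0.30) :
    ∃ ψ : Momentum → ℝ, IsChannelState (squareDispersion 1 0) (chemicalPotentialOfDensity (squareDispersion 1 0) (1 - δ)) D4Irrep.B1g ψ ∧
      ∀ U : ℝ, 0 < U → U ≤ ((klU0WindowD010D030U : ℚ) : ℝ) → ∀ χ : D4Irrep, χ ≠ D4Irrep.B1g →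
        ∀ φ : Momentum → ℝ, IsChannelState (squareDispersion 1 0) (chemicalPotentialOfDensity (squareDispersion 1 0) (1 - δ)) χ φ →
          thirdOrderForm (squareDispersion 1 0) (chemicalPotentialOfDensity (squareDispersion 1 0) (1 - δ)) U ψ < thirdOrderForm (squareDispersion 1 0) (chemicalPotentialOfDensity (squareDispersion 1 0) (1 - δ)) U φ := by
  obtain ⟨h₁, h₂⟩ := muOfDoping_mem_window_d010_d030 δ hδ
  exact klThirdOrder_selection_d010d030 hY hX hZ hA hB hC h3 _ (by push_cast; linarith) (by push_cast; linarith)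

/-- **For every `δ ∈ [0.10, 0.30]`, chains resummed**: `B1g` selection in `resummedForm` at `μ(δ)` for `0 < U ≤ klU0WindowD010D030U`. [cite: ScalapinoLohHirsch1986, (3)-(4)] -/
theorem klResummed_selection_d010d030_doping (hY : klCertB1gWinY.EnclosuresB1g) (hX : klCertB1gWinX.EnclosuresB1g) (hZ : klCertB1gWinZ.EnclosuresB1g) (hA : klCertB1gWinA.EnclosuresB1g) (hB : klCertB1gWinB.EnclosuresB1g) (hC : klCertB1gWinC.EnclosuresB1g)
    (h3 : KlResummedWindowEnclosures klU0WindowD010D030Rows [klCertB1gWinY, klCertB1gWinX, klCertB1gWinZ, klCertB1gWinA, klCertB1gWinB, klCertB1gWinC])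
    (δ : ℝ) (hδ : δ ∈ Set.Icc (0.10 : ℝ) 0.30) :
    ∃ ψ : Momentum → ℝ, IsChannelState (squareDispersion 1 0) (chemicalPotentialOfDensity (squareDispersion 1 0) (1 - δ)) D4Irrep.B1g ψ ∧
      ∀ U : ℝ, 0 < U → U ≤ ((klU0WindowD010D030U : ℚ) : ℝ) → ∀ χ : D4Irrep, χ ≠ D4Irrep.B1g →
        ∀ φ : Momentum → ℝ, IsChannelState (squareDispersion 1 0) (chemicalPotentialOfDensity (squareDispersion 1 0) (1 - δ)) χ φ →
          resummedForm (squareDispersion 1 0) (chemicalPotentialOfDensity (squareDispersion 1 0) (1 - δ)) U ψ < resummedForm (squareDispersion 1 0) (chemicalPotentialOfDensity (squareDispersion 1 0) (1 - δ)) U φ := by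
  obtain ⟨h₁, h₂⟩ := muOfDoping_mem_window_d010_d030 δ hδ
  exact klResummed_selection_d010d030 hY hX hZ hA hB hC h3 _ (by push_cast; linarith) (by push_cast; linarith)

/-- **For every `δ ∈ [0.10, 0.30]`, channel bottoms**: at `μ(δ)`, every `0 < U ≤ klU0WindowD010D030U`, every `χ ≠ B1g`:
`channelInf3 ε₀ μ(δ) U B1g < channelInf3 ε₀ μ(δ) U χ`. [cite: RaghuKivelsonScalapino2010, App. A] -/
theorem klThirdOrder_channelInf3_lt_d010d030_doping (hY : klCertB1gWinY.EnclosuresB1g) (hX : klCertB1gWinX.EnclosuresB1g) (hZ : klCertB1gWinZ.EnclosuresB1g) (hA : klCertB1gWinA.EnclosuresB1g) (hB : klCertB1gWinB.EnclosuresB1g) (hC : klCertB1gWinC.EnclosuresB1g)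
    (h3 : KlThirdOrderWindowEnclosures klU0WindowD010D030Rows [klCertB1gWinY, klCertB1gWinX, klCertB1gWinZ, klCertB1gWinA, klCertB1gWinB, klCertB1gWinC])
    (hB1g : ∀ w ∈ klU0WindowD010D030Rows, ∀ μ : ℝ, ((w.mulo : ℚ) : ℝ) ≤ μ → μ ≤ ((w.muhi : ℚ) : ℝ) →
      (w.row.chanOf D4Irrep.A2g).ThirdOrderLowerBound μ D4Irrep.B1g)
    (δ : ℝ) (hδ : δ ∈ Set.Icc (0.10 : ℝ) 0.30) :
    ∀ U : ℝ, 0 < U → U ≤ ((klU0WindowD010D030U : ℚ) : ℝ) → ∀ χ : D4Irrep, χ ≠ D4Irrep.B1g →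
      channelInf3 (squareDispersion 1 0) (chemicalPotentialOfDensity (squareDispersion 1 0) (1 - δ)) U D4Irrep.B1g < channelInf3 (squareDispersion 1 0) (chemicalPotentialOfDensity (squareDispersion 1 0) (1 - δ)) U χ := by
  obtain ⟨h₁, h₂⟩ := muOfDoping_mem_window_d010_d030 δ hδ
  exact klThirdOrder_channelInf3_lt_d010d030 hY hX hZ hA hB hC h3 hB1g _ (by push_cast; linarith) (by push_cast; linarith)

end Summit.HubbardSuperconductivity.HubbardSuperconductivity.Theorems

end
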